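import Summits.CriticalPhenomena.PercolationContinuityZ3.Theorems.PercNearOneGluingNoHeavyLowerTailQ44ComplementaryPacking
import Mathlib.Algebra.BigOperators.Group.Finset.Powerset
import HarnessLib

/-!
# The polar lemma (antipodal Gladkov inequality for any number of parts) by Gladkov's one-coordinate induction

Support file for crux `stmt-CriticalPhenomena-4575` (master-family programme, `prim-bnk-1` gen 37; memo
`run/shared/lean/prim/prim-l12/FROM-prim-bnk-1-gen37-POLAR-GLADKOV.md`).  Pure finite combinatorics; no definitions,
no named facts, no sorries.

THE STATEMENT (memo gen 36 §3, "POLAR LEMMA", there a conjecture checked exhaustively for `|E| ≤ 5`).  Label the subsets of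
a finite set by `f : Finset α → β` with two distinguished labels `bot ≠ top` ("GLADKOV LABELLING"): whenever `S ⊆ T`,
`f S = f T ∨ f S = bot ∨ f T = top` — equivalently `f ⁻¹ bot` is a down-set `D`, `f ⁻¹ top` an up-set `T`, and every other
label class `Cᵢ` is convex with `T ∪ Cᵢ` an up-set and `D ∪ Cᵢ` a down-set (the components of the middle region of the memo,
or any coarsening of them; Gladkov's hypothesis "all `A ∪ Cᵢ` closed upwards").  Then on every cube `2^E`
  `#{S ⊆ E : f S, f (E∖S) are two DIFFERENT middle labels} ≤ #{S ⊆ E : {f S, f (E∖S)} = {bot, top}}`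
(`PolarGladkov.card_cross_le_card_polar`; over a `Fintype` with complements: `… ≤ 2·#{S : f S = top, f Sᶜ = bot}`,
`card_cross_le_two_mul_card_polar`).  This is the two-copy FIBRE (antipodal-count) form of Gladkov's strong Harris–Kleitman
inequality `μ(A)μ(B) ≥ e₂(μ(C₁),…,μ(C_k))` (tree: `Literature.Probability.LatticeModels.prodBernoulli_strongHarris`,
Gladkov 2024 BLMS Thm. 2.1) for ANY number of parts; the three-part case (`M₃`-valued maps) is the tree's
`SunflowerPartition.Sunflower.card_distinctPetals_le`, the two-part case is `PolarMS.card_cross_le_card_polar` (gen 36).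

THE PROOF is Gladkov's induction on one coordinate read at the fibre: exposing `e`, the four labels
`x = f S, x' = f (S+e), y = f (E'∖S), y' = f (E'∖S + e)` satisfy the POINTWISE exchange inequality
`P x y' + P x' y + C x y + C x' y' ≥ P x y + P x' y' + C x y' + C x' y` (`polar_step`; `P` = polar indicator, `C` = cross
indicator) — exactly the statement that Gladkov's `p²`-coefficient is `≤ 0`, valid for every nonnegative symmetric bi-additive
form, not only for product measures — and summing it turns the level-`E` count into the two facet counts (`sum_le_sum_of_facet_step`,
stated for an arbitrary one-step relation `R` and arbitrary `P, C : β → β → ℕ`, reusable for other kernels).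

ALONG A MONOTONE FOUR-POINT CELL MAP (`TwoCopyMono`): for every Gladkov labelling `lab : Fin 15 → β` of the cell order `ple`
(`ple i j → lab i = lab j ∨ lab i = bot ∨ lab j = top`, a decidable table) the kernel `2·[lab i = top][lab j = bot] − [lab i, lab j
distinct middle labels]` is a `GoodKernel` (`goodKernel_polar`), with the law-level form
`Σ_{(i,j) cross} c_i c_j ≤ 2·Σ_{lab i = top, lab j = bot} c_i c_j` on every finite weighted graph (`sum_cross_le_of_labelling`).
Instances (tables by `decide`): the seven two-block cells against {≥ 3 blocks} × {abcy} (`e2_twoBlock_le`, Gladkov `k = 7`),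
the six pair cells against {a|b|c|y} × {≤ 2 blocks} (`e2_pairs_le`, `k = 6`), and the three perfect matchings (`e2_matchings_le`,
`k = 3`, refining `PolarMS.crossing_vs_pairing_le`).
-/

namespace Summit.CriticalPhenomena.PercolationContinuityZ3.Theorems

namespace PolarGladkov

open Finset

/-! ## Gladkov's one-coordinate induction at the fibre, abstract form -/

section Abstract

variable {α : Type*} [DecidableEq α] {β : Type*}

/-- **Facet induction.**  Let `R` be a one-step relation on labels and `P C : β → β → ℕ` two pair weights such that
(step) `P x y + P x' y' + C x y' + C x' y ≤ P x y' + P x' y + C x y + C x' y'` whenever `R x x'` and `R y y'`, and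
(base) `C u u ≤ P u u`.  Then for every labelling `f` of the subsets of `E` whose one-element extensions inside `E` are `R`-steps,
`Σ_{S ⊆ E} C (f S) (f (E ∖ S)) ≤ Σ_{S ⊆ E} P (f S) (f (E ∖ S))`.  (Exposing `e ∈ E` writes both sums over `S ⊆ E ∖ e` in terms of
the four labels `f S, f (S+e), f (E∖e∖S), f (E∖S)`; the step inequality trades the two antipodal terms for the two facet terms,
to which the induction hypothesis applies.) [this work] -/
theorem sum_le_sum_of_facet_step (R : β → β → Prop) (P C : β → β → ℕ)
    (hstep : ∀ x x' y y' : β, R x x' → R y y' → P x y + P x' y' + C x y' + C x' y ≤ P x y' + P x' y + C x y + C x' y')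
    (hbase : ∀ u : β, C u u ≤ P u u) (E : Finset α) :
    ∀ f : Finset α → β, (∀ S : Finset α, S ⊆ E → ∀ a ∈ E, a ∉ S → R (f S) (f (insert a S))) →
      ∑ S ∈ E.powerset, C (f S) (f (E \ S)) ≤ ∑ S ∈ E.powerset, P (f S) (f (E \ S)) := by
  induction E using Finset.induction_on with
  | empty =>
    intro f _
    simp only [Finset.powerset_empty, Finset.sum_singleton, sdiff_self, bot_eq_empty]
    exact hbase (f ∅)
  | insert e E' he ih =>
    intro f hf
    rw [Finset.sum_powerset_insert he, Finset.sum_powerset_insert he]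
    -- the complements inside `insert e E'`
    have hc1 : ∀ S ∈ E'.powerset, insert e E' \ S = insert e (E' \ S) := by
      intro S hS
      have hSE : S ⊆ E' := Finset.mem_powerset.1 hS
      have heS : e ∉ S := fun h => he (hSE h)
      ext x
      simp only [Finset.mem_sdiff, Finset.mem_insert]
      constructor
      · rintro ⟨h1 | h1, h2⟩
        · exact Or.inl h1
        · exact Or.inr ⟨h1, h2⟩
      · rintro (h1 | ⟨h1, h2⟩)
        · exact ⟨Or.inl h1, fun h => heS (h1 ▸ h)⟩
        · exact ⟨Or.inr h1, h2⟩
    have hc2 : ∀ S ∈ E'.powerset, insert e E' \ insert e S = E' \ S := by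
      intro S hS
      ext x
      simp only [Finset.mem_sdiff, Finset.mem_insert, not_or]
      constructor
      · rintro ⟨h1 | h1, h2, h3⟩
        · exact (h2 h1).elim
        · exact ⟨h1, h3⟩
      · rintro ⟨h1, h2⟩
        exact ⟨Or.inr h1, fun h => he (h ▸ h1), h2⟩
    have eC1 : ∑ S ∈ E'.powerset, C (f S) (f (insert e E' \ S)) = ∑ S ∈ E'.powerset, C (f S) (f (insert e (E' \ S))) :=
      Finset.sum_congr rfl fun S hS => by rw [hc1 S hS]
    have eC2 : ∑ S ∈ E'.powerset, C (f (insert e S)) (f (insert e E' \ insert e S)) =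
        ∑ S ∈ E'.powerset, C (f (insert e S)) (f (E' \ S)) :=
      Finset.sum_congr rfl fun S hS => by rw [hc2 S hS]
    have eP1 : ∑ S ∈ E'.powerset, P (f S) (f (insert e E' \ S)) = ∑ S ∈ E'.powerset, P (f S) (f (insert e (E' \ S))) :=
      Finset.sum_congr rfl fun S hS => by rw [hc1 S hS]
    have eP2 : ∑ S ∈ E'.powerset, P (f (insert e S)) (f (insert e E' \ insert e S)) =
        ∑ S ∈ E'.powerset, P (f (insert e S)) (f (E' \ S)) :=
      Finset.sum_congr rfl fun S hS => by rw [hc2 S hS]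
    rw [eC1, eC2, eP1, eP2]
    -- induction hypotheses for the two facets
    have hf0 : ∀ S : Finset α, S ⊆ E' → ∀ a ∈ E', a ∉ S → R (f S) (f (insert a S)) :=
      fun S hS a ha haS => hf S (hS.trans (Finset.subset_insert e E')) a (Finset.mem_insert_of_mem ha) haS
    have hf1 : ∀ S : Finset α, S ⊆ E' → ∀ a ∈ E', a ∉ S →
        R (f (insert e S)) (f (insert e (insert a S))) := by
      intro S hS a ha haS
      have hae : a ≠ e := fun h => he (h ▸ ha)
      have h := hf (insert e S) (Finset.insert_subset_insert e hS) a (Finset.mem_insert_of_mem ha)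
        (by rw [Finset.mem_insert, not_or]; exact ⟨hae, haS⟩)
      rwa [Finset.insert_comm] at h
    have ih0 := ih f hf0
    have ih1 := ih (fun S => f (insert e S)) hf1
    -- the pointwise step, summed
    have hsum : ∑ S ∈ E'.powerset, (P (f S) (f (E' \ S)) + P (f (insert e S)) (f (insert e (E' \ S))) +
          C (f S) (f (insert e (E' \ S))) + C (f (insert e S)) (f (E' \ S))) ≤
        ∑ S ∈ E'.powerset, (P (f S) (f (insert e (E' \ S))) + P (f (insert e S)) (f (E' \ S)) +
          C (f S) (f (E' \ S)) + C (f (insert e S)) (f (insert e (E' \ S)))) := by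
      refine Finset.sum_le_sum fun S hS => ?_
      have hSE : S ⊆ E' := Finset.mem_powerset.1 hS
      have heS : e ∉ S := fun h => he (hSE h)
      refine hstep _ _ _ _ (hf S (hSE.trans (Finset.subset_insert e E')) e (Finset.mem_insert_self e E') heS)
        (hf (E' \ S) (Finset.sdiff_subset.trans (Finset.subset_insert e E')) e (Finset.mem_insert_self e E') ?_)
      rw [Finset.mem_sdiff, not_and_or]
      exact Or.inl he
    simp only [Finset.sum_add_distrib] at hsum
    omega

/-- **The pointwise exchange inequality of a Gladkov labelling** (Gladkov's "`p²`-coefficient" step, read at the fibre).  With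
`P u v = [ {u, v} = {bot, top} ]` and `C u v = [u, v are two different labels, neither bot nor top]`, for every pair of one-step
transitions `x → x'`, `y → y'` (`x = x' ∨ x = bot ∨ x' = top`, same for `y`):
`P x y + P x' y' + C x y' + C x' y ≤ P x y' + P x' y + C x y + C x' y'`. [cite: Gladkov2024StrongFKG, proof of Thm. 2.1 (the
coefficient of `p²`)] -/
theorem polar_step [DecidableEq β] (bot top : β) (hbt : bot ≠ top) (x x' y y' : β)
    (hx : x = x' ∨ x = bot ∨ x' = top) (hy : y = y' ∨ y = bot ∨ y' = top) :
    (if (x = top ∧ y = bot) ∨ (x = bot ∧ y = top) then 1 else 0) +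
        (if (x' = top ∧ y' = bot) ∨ (x' = bot ∧ y' = top) then 1 else 0) +
        (if x ≠ bot ∧ x ≠ top ∧ y' ≠ bot ∧ y' ≠ top ∧ x ≠ y' then 1 else 0) +
        (if x' ≠ bot ∧ x' ≠ top ∧ y ≠ bot ∧ y ≠ top ∧ x' ≠ y then 1 else 0) ≤
      (if (x = top ∧ y' = bot) ∨ (x = bot ∧ y' = top) then 1 else 0) +
        (if (x' = top ∧ y = bot) ∨ (x' = bot ∧ y = top) then 1 else 0) +
        (if x ≠ bot ∧ x ≠ top ∧ y ≠ bot ∧ y ≠ top ∧ x ≠ y then 1 else 0) +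
        (if x' ≠ bot ∧ x' ≠ top ∧ y' ≠ bot ∧ y' ≠ top ∧ x' ≠ y' then 1 else 0) := by
  have htb : top ≠ bot := fun h => hbt h.symm
  have tri : ∀ u : β, u = bot ∨ u = top ∨ (u ≠ bot ∧ u ≠ top) := by
    intro u
    by_cases h1 : u = bot
    · exact Or.inl h1
    by_cases h2 : u = top
    · exact Or.inr (Or.inl h2)
    · exact Or.inr (Or.inr ⟨h1, h2⟩)
  rcases hx with hx | hx | hx <;> rcases hy with hy | hy | hy
  · -- stay / stay
    subst hx; subst hy; omega
  · -- stay / y = bot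
    subst hx; subst hy; omega
  · -- stay / y' = top
    subst hx; subst hy; omega
  · -- x = bot / stay
    subst hx; subst hy; omega
  · -- x = bot / y = bot : unknowns x', y'
    rw [hx, hy]
    rcases tri x' with h1 | h1 | ⟨h1, h1'⟩ <;> rcases tri y' with h2 | h2 | ⟨h2, h2'⟩ <;>
      (try by_cases h3 : x' = y') <;> simp [*]
  · -- x = bot / y' = top : unknowns x', y
    rw [hx, hy]
    rcases tri x' with h1 | h1 | ⟨h1, h1'⟩ <;> rcases tri y with h2 | h2 | ⟨h2, h2'⟩ <;>
      (try by_cases h3 : x' = y) <;> simp [*]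
  · -- x' = top / stay
    subst hx; subst hy; omega
  · -- x' = top / y = bot : unknowns x, y'
    rw [hx, hy]
    rcases tri x with h1 | h1 | ⟨h1, h1'⟩ <;> rcases tri y' with h2 | h2 | ⟨h2, h2'⟩ <;>
      (try by_cases h3 : x = y') <;> simp [*]
  · -- x' = top / y' = top : unknowns x, y
    rw [hx, hy]
    rcases tri x with h1 | h1 | ⟨h1, h1'⟩ <;> rcases tri y with h2 | h2 | ⟨h2, h2'⟩ <;>
      (try by_cases h3 : x = y) <;> simp [*]

/-- **The polar lemma / antipodal Gladkov inequality, any number of parts** (relative form on a cube `2^E`).  For a Gladkov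
labelling `f` (`S ⊆ T ⊆ E → f S = f T ∨ f S = bot ∨ f T = top`, `bot ≠ top`):
`#{S ⊆ E : f S, f (E ∖ S) two different middle labels} ≤ #{S ⊆ E : {f S, f (E ∖ S)} = {bot, top}}`. [this work] -/
theorem card_cross_le_card_polar [DecidableEq β] (bot top : β) (hbt : bot ≠ top) (E : Finset α) (f : Finset α → β)
    (hf : ∀ S T : Finset α, S ⊆ T → T ⊆ E → f S = f T ∨ f S = bot ∨ f T = top) :
    #(E.powerset.filter fun S => f S ≠ bot ∧ f S ≠ top ∧ f (E \ S) ≠ bot ∧ f (E \ S) ≠ top ∧ f S ≠ f (E \ S)) ≤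
      #(E.powerset.filter fun S => (f S = top ∧ f (E \ S) = bot) ∨ (f S = bot ∧ f (E \ S) = top)) := by
  rw [Finset.card_filter, Finset.card_filter]
  refine sum_le_sum_of_facet_step (fun u v : β => u = v ∨ u = bot ∨ v = top)
    (fun u v : β => if (u = top ∧ v = bot) ∨ (u = bot ∧ v = top) then 1 else 0)
    (fun u v : β => if u ≠ bot ∧ u ≠ top ∧ v ≠ bot ∧ v ≠ top ∧ u ≠ v then 1 else 0)
    (fun x x' y y' hx hy => polar_step bot top hbt x x' y y' hx hy) (fun u => by simp) E f ?_
  intro S hS a ha haS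
  exact hf S (insert a S) (Finset.subset_insert a S) (Finset.insert_subset ha hS)

variable [Fintype α]

/-- **Antipodal Gladkov inequality on the whole cube, with complements**: for a Gladkov labelling `f` of `Finset α`,
`#{S : f S, f Sᶜ two different middle labels} ≤ 2 · #{S : f S = top, f Sᶜ = bot}`. [this work] -/
theorem card_cross_le_two_mul_card_polar [DecidableEq β] (bot top : β) (hbt : bot ≠ top) (f : Finset α → β)
    (hf : ∀ S T : Finset α, S ⊆ T → f S = f T ∨ f S = bot ∨ f T = top) :
    #(Finset.univ.filter fun S : Finset α => f S ≠ bot ∧ f S ≠ top ∧ f Sᶜ ≠ bot ∧ f Sᶜ ≠ top ∧ f S ≠ f Sᶜ) ≤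
      2 * #(Finset.univ.filter fun S : Finset α => f S = top ∧ f Sᶜ = bot) := by
  have h := card_cross_le_card_polar bot top hbt (Finset.univ : Finset α) f (fun S T hST _ => hf S T hST)
  simp only [Finset.powerset_univ, ← Finset.compl_eq_univ_sdiff] at h
  -- split the symmetric polar count into its two halves and swap one of them
  have hsplit : #(Finset.univ.filter fun S : Finset α => (f S = top ∧ f Sᶜ = bot) ∨ (f S = bot ∧ f Sᶜ = top)) ≤
      #(Finset.univ.filter fun S : Finset α => f S = top ∧ f Sᶜ = bot) +
        #(Finset.univ.filter fun S : Finset α => f S = bot ∧ f Sᶜ = top) := by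
    rw [Finset.filter_or]
    exact Finset.card_union_le _ _
  have hswap : (Finset.univ.filter fun S : Finset α => f S = bot ∧ f Sᶜ = top) =
      (Finset.univ.filter fun S : Finset α => f S = top ∧ f Sᶜ = bot).map ⟨compl, compl_injective⟩ := by
    ext S
    simp only [Finset.mem_filter, Finset.mem_univ, true_and, Finset.mem_map, Function.Embedding.coeFn_mk]
    constructor
    · rintro ⟨h1, h2⟩
      exact ⟨Sᶜ, ⟨h2, by rw [compl_compl]; exact h1⟩, compl_compl S⟩
    · rintro ⟨T, ⟨h1, h2⟩, rfl⟩
      exact ⟨h2, by rw [compl_compl]; exact h1⟩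
  rw [hswap, Finset.card_map] at hsplit
  omega

end Abstract

/-! ## Along a monotone four-point cell map -/

open TwoCopyMono FourPointAtoms

variable {β : Type*} [DecidableEq β]

/-- **The polar count along a monotone cell map**: for a Gladkov labelling `lab` of the cell order `ple` (table hypothesis `htab`),
`#{S : lab (ι S), lab (ι Sᶜ) two different middle labels} ≤ 2 · #{S : lab (ι S) = top, lab (ι Sᶜ) = bot}`. [this work] -/
theorem card_cross_le_two_mul_card_polar_cells {γ : Type*} [Fintype γ] [DecidableEq γ] (ι : Finset γ → Fin 15)
    (hmono : ∀ X Y : Finset γ, X ⊆ Y → ple (ι X) (ι Y) = true) (lab : Fin 15 → β) (bot top : β) (hbt : bot ≠ top)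
    (htab : ∀ i j : Fin 15, ple i j = true → lab i = lab j ∨ lab i = bot ∨ lab j = top) :
    #(Finset.univ.filter fun S : Finset γ => lab (ι S) ≠ bot ∧ lab (ι S) ≠ top ∧ lab (ι Sᶜ) ≠ bot ∧ lab (ι Sᶜ) ≠ top ∧
        lab (ι S) ≠ lab (ι Sᶜ)) ≤
      2 * #(Finset.univ.filter fun S : Finset γ => lab (ι S) = top ∧ lab (ι Sᶜ) = bot) :=
  card_cross_le_two_mul_card_polar bot top hbt (fun S => lab (ι S)) fun S T hST => htab _ _ (hmono S T hST)

/-- The antipodal sum of the polar kernel `2·[lab i = top][lab j = bot] − [cross]` along a cell map, in point counts. [this work] -/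
theorem sum_kerPolar_map {γ : Type*} [Fintype γ] [DecidableEq γ] (lab : Fin 15 → β) (bot top : β) (ι : Finset γ → Fin 15) :
    (∑ T : Finset γ, ((2 * (if lab (ι T) = top ∧ lab (ι Tᶜ) = bot then 1 else 0) -
        (if lab (ι T) ≠ bot ∧ lab (ι T) ≠ top ∧ lab (ι Tᶜ) ≠ bot ∧ lab (ι Tᶜ) ≠ top ∧ lab (ι T) ≠ lab (ι Tᶜ) then 1 else 0)) : ℤ)) =
      2 * (#(Finset.univ.filter fun S : Finset γ => lab (ι S) = top ∧ lab (ι Sᶜ) = bot) : ℤ) -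
        (#(Finset.univ.filter fun S : Finset γ => lab (ι S) ≠ bot ∧ lab (ι S) ≠ top ∧ lab (ι Sᶜ) ≠ bot ∧ lab (ι Sᶜ) ≠ top ∧
          lab (ι S) ≠ lab (ι Sᶜ)) : ℤ) := by
  rw [Finset.sum_sub_distrib, ← Finset.mul_sum, Finset.natCast_card_filter, Finset.natCast_card_filter]

/-- **Polar kernels are good**: for every Gladkov labelling `lab` of the cell order, the kernel
`2·[lab i = top][lab j = bot] − [lab i, lab j two different middle labels]` is a `TwoCopyMono.GoodKernel`. [this work] -/
theorem goodKernel_polar (lab : Fin 15 → β) (bot top : β) (hbt : bot ≠ top)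
    (htab : ∀ i j : Fin 15, ple i j = true → lab i = lab j ∨ lab i = bot ∨ lab j = top) :
    GoodKernel (fun i j => 2 * (if lab i = top ∧ lab j = bot then 1 else 0) -
      (if lab i ≠ bot ∧ lab i ≠ top ∧ lab j ≠ bot ∧ lab j ≠ top ∧ lab i ≠ lab j then 1 else 0)) := by
  classical
  refine ⟨fun γ _ _ P hmono heqv => ?_⟩
  have hex : ∀ T : Finset γ, ∃ i : Fin 15, P T = pp i := fun T => exists_pat_of_isEqv (heqv T)
  choose ι hι using hex
  have hle : ∀ X Y : Finset γ, X ⊆ Y → ple (ι X) (ι Y) = true := by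
    intro X Y hXY
    apply ple_of_profLE
    rw [← hι X, ← hι Y]
    exact hmono X Y hXY
  have hc := card_cross_le_two_mul_card_polar_cells ι hle lab bot top hbt htab
  have hP : (∑ T : Finset γ, liftK (fun i j => 2 * (if lab i = top ∧ lab j = bot then 1 else 0) -
      (if lab i ≠ bot ∧ lab i ≠ top ∧ lab j ≠ bot ∧ lab j ≠ top ∧ lab i ≠ lab j then 1 else 0)) (P T) (P Tᶜ)) =
      ∑ T : Finset γ, ((2 * (if lab (ι T) = top ∧ lab (ι Tᶜ) = bot then 1 else 0) -
        (if lab (ι T) ≠ bot ∧ lab (ι T) ≠ top ∧ lab (ι Tᶜ) ≠ bot ∧ lab (ι Tᶜ) ≠ top ∧ lab (ι T) ≠ lab (ι Tᶜ)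
          then 1 else 0)) : ℤ) := by
    refine Finset.sum_congr rfl fun T _ => ?_
    rw [hι T, hι Tᶜ, liftK_pp]
  rw [hP, sum_kerPolar_map]
  have : (#(Finset.univ.filter fun S : Finset γ => lab (ι S) ≠ bot ∧ lab (ι S) ≠ top ∧ lab (ι Sᶜ) ≠ bot ∧ lab (ι Sᶜ) ≠ top ∧
      lab (ι S) ≠ lab (ι Sᶜ)) : ℤ) ≤ 2 * (#(Finset.univ.filter fun S : Finset γ => lab (ι S) = top ∧ lab (ι Sᶜ) = bot) : ℤ) := by
    exact_mod_cast hc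
  linarith

/-! ## Law level -/

variable {n : ℕ}

/-- **Law-level antipodal Gladkov inequality along a labelling of the cells.**  For a Gladkov labelling `lab` of the cell order and
pair sets `TB = {(i,j) : lab i = top, lab j = bot}`, `CR = {(i,j) : lab i, lab j two different middle labels}` (given by their
membership tables), on every finite weighted graph and all marked points `Σ_{(i,j) ∈ CR} c_i c_j ≤ 2·Σ_{(i,j) ∈ TB} c_i c_j`.
At law level this is Gladkov's Thm. 2.1 for the pattern law; the fibre count above is the new content. [this work] -/
theorem sum_cross_le_of_labelling (lab : Fin 15 → β) (bot top : β) (hbt : bot ≠ top)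
    (htab : ∀ i j : Fin 15, ple i j = true → lab i = lab j ∨ lab i = bot ∨ lab j = top)
    (TB CR : Finset (Fin 15 × Fin 15)) (hTB : ∀ p : Fin 15 × Fin 15, p ∈ TB ↔ (lab p.1 = top ∧ lab p.2 = bot))
    (hCR : ∀ p : Fin 15 × Fin 15, p ∈ CR ↔
      (lab p.1 ≠ bot ∧ lab p.1 ≠ top ∧ lab p.2 ≠ bot ∧ lab p.2 ≠ top ∧ lab p.1 ≠ lab p.2))
    (w : Sym2 (Fin n) → unitInterval) (a b c y : Fin n) :
    (∑ p ∈ CR, cell w a b c y p.1 * cell w a b c y p.2) ≤ 2 * ∑ p ∈ TB, cell w a b c y p.1 * cell w a b c y p.2 := by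
  have h0 := sum_kernel_cell_nonneg (goodKernel_polar lab bot top hbt htab) w a b c y
  have hK : ∀ i j : Fin 15, ((2 * (if lab i = top ∧ lab j = bot then 1 else 0) -
      (if lab i ≠ bot ∧ lab i ≠ top ∧ lab j ≠ bot ∧ lab j ≠ top ∧ lab i ≠ lab j then 1 else 0) : ℤ) : ℝ) *
        cell w a b c y i * cell w a b c y j =
      2 * ((indK TB i j : ℝ) * cell w a b c y i * cell w a b c y j) - (indK CR i j : ℝ) * cell w a b c y i * cell w a b c y j := by
    intro i j
    unfold indK
    simp only [hTB (i, j), hCR (i, j)]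
    push_cast
    ring
  simp_rw [hK, Finset.sum_sub_distrib, ← Finset.mul_sum] at h0
  rw [sum_indK_cell, sum_indK_cell] at h0
  linarith

/-! ## Instances (tables by `decide`)

Cells `pat4`: `0 a|b|c|y, 1 cy, 2 by, 3 bc, 4 ay, 5 ac, 6 ab, 7 bcy, 8 ay|bc, 9 ac|by, 10 acy, 11 ab|cy, 12 aby, 13 abc, 14 abcy`. -/

/-- **Gladkov `k = 7` at the fibre: the seven two-block cells.**  With `bot` = the seven cells with `≥ 3` blocks and `top = abcy`,
the seven two-block cells `7,…,13` are pairwise incomparable middle classes; hence on every finite weighted graph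
`Σ_{i ≠ j two-block} c_i c_j ≤ 2 · c₁₄ · (c₀ + c₁ + ⋯ + c₆)`, i.e. `e₂(c₇,…,c₁₃) ≤ P(one block)·P(at least three blocks)`. [this work] -/
theorem e2_twoBlock_le (w : Sym2 (Fin n) → unitInterval) (a b c y : Fin n) :
    (∑ p ∈ ({7, 8, 9, 10, 11, 12, 13} : Finset (Fin 15)).offDiag, cell w a b c y p.1 * cell w a b c y p.2) ≤
      2 * ∑ p ∈ ({14} : Finset (Fin 15)) ×ˢ ({0, 1, 2, 3, 4, 5, 6} : Finset (Fin 15)), cell w a b c y p.1 * cell w a b c y p.2 :=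
  sum_cross_le_of_labelling (![0, 0, 0, 0, 0, 0, 0, 7, 8, 9, 10, 11, 12, 13, 14] : Fin 15 → Fin 15) 0 14 (by decide) (by decide)
    _ _
    (fun p => by
      obtain ⟨i, j⟩ := p
      simp only [Finset.mem_product, Finset.mem_insert, Finset.mem_singleton]
      revert i j; decide)
    (fun p => by
      obtain ⟨i, j⟩ := p
      simp only [Finset.mem_insert, Finset.mem_singleton, Finset.mem_offDiag]
      revert i j; decide) w a b c y

/-- **Gladkov `k = 6` at the fibre: the six pair cells.**  With `bot = a|b|c|y` and `top` = the eight cells with `≤ 2` blocks, the six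
pair cells `1,…,6` are pairwise incomparable middle classes; hence `Σ_{i ≠ j pairs} c_i c_j ≤ 2 · c₀ · (c₇ + ⋯ + c₁₄)`, i.e.
`e₂(c₁,…,c₆) ≤ P(four blocks)·P(at most two blocks)`. [this work] -/
theorem e2_pairs_le (w : Sym2 (Fin n) → unitInterval) (a b c y : Fin n) :
    (∑ p ∈ ({1, 2, 3, 4, 5, 6} : Finset (Fin 15)).offDiag, cell w a b c y p.1 * cell w a b c y p.2) ≤
      2 * ∑ p ∈ ({7, 8, 9, 10, 11, 12, 13, 14} : Finset (Fin 15)) ×ˢ ({0} : Finset (Fin 15)), cell w a b c y p.1 * cell w a b c y p.2 :=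
  sum_cross_le_of_labelling (![0, 1, 2, 3, 4, 5, 6, 14, 14, 14, 14, 14, 14, 14, 14] : Fin 15 → Fin 15) 0 14 (by decide) (by decide)
    _ _
    (fun p => by
      obtain ⟨i, j⟩ := p
      simp only [Finset.mem_product, Finset.mem_insert, Finset.mem_singleton]
      revert i j; decide)
    (fun p => by
      obtain ⟨i, j⟩ := p
      simp only [Finset.mem_insert, Finset.mem_singleton, Finset.mem_offDiag]
      revert i j; decide) w a b c y

/-- **Gladkov `k = 3` at the fibre: the three perfect matchings.**  With `bot = a|b|c|y` and `top` = {three-block-free cells with a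
triple or everything joined} = `{7, 10, 12, 13, 14}`, the middle splits into the three matchings `{cy, ab, ab|cy}`, `{by, ac, ac|by}`,
`{bc, ay, ay|bc}`; hence `Σ_{i,j in different matchings} c_i c_j ≤ 2 · c₀ · (c₇ + c₁₀ + c₁₂ + c₁₃ + c₁₄)` — the three-part
refinement of `PolarMS.crossing_vs_pairing_le`. [this work] -/
theorem e2_matchings_le (w : Sym2 (Fin n) → unitInterval) (a b c y : Fin n) :
    (∑ p ∈ (({1, 6, 11} : Finset (Fin 15)) ×ˢ ({2, 5, 9, 3, 4, 8} : Finset (Fin 15))) ∪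
        (({2, 5, 9} : Finset (Fin 15)) ×ˢ ({1, 6, 11, 3, 4, 8} : Finset (Fin 15))) ∪
        (({3, 4, 8} : Finset (Fin 15)) ×ˢ ({1, 6, 11, 2, 5, 9} : Finset (Fin 15))),
        cell w a b c y p.1 * cell w a b c y p.2) ≤
      2 * ∑ p ∈ ({7, 10, 12, 13, 14} : Finset (Fin 15)) ×ˢ ({0} : Finset (Fin 15)), cell w a b c y p.1 * cell w a b c y p.2 :=
  sum_cross_le_of_labelling (![0, 1, 2, 3, 3, 2, 1, 14, 3, 2, 14, 1, 14, 14, 14] : Fin 15 → Fin 15) 0 14 (by decide) (by decide)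
    _ _
    (fun p => by
      obtain ⟨i, j⟩ := p
      simp only [Finset.mem_product, Finset.mem_insert, Finset.mem_singleton]
      revert i j; decide)
    (fun p => by
      obtain ⟨i, j⟩ := p
      simp only [Finset.mem_product, Finset.mem_insert, Finset.mem_singleton, Finset.mem_union]
      revert i j; decide) w a b c y

end PolarGladkov

end Summit.CriticalPhenomena.PercolationContinuityZ3.Theorems
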